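import Summits.CriticalPhenomena.PercolationContinuityZ3.Theorems.Transplant.HalfSpaceUniquenessSide
import HarnessLib

/-!
# The port lemma: every inner-boundary vertex of the box is wired to the top slab through exterior steps

builds on p205010 (kernel theorem, internal audit signed; external expert review pending) — nothing in this file uses p205010.
Lane `prim-bschramm`, seat `prim-bschramm-p2` gen 16 (class C1b); helper file (`--supports stmt-CriticalPhenomena-4575 --as helper`)
for the half-space uniqueness programme (TARGET 3g, Barsky–Grimmett–Newman 1991 Cor. (iii) by the Aizenman–Chayes–Chayes–Fröhlich–
Russo mechanism).  Continues `HalfSpaceUniquenessSide` (the side-face design: apex `a`, port `w`, regions, `sideEvent`).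

* **`sideEvent_move`** — the deterministic heart: on `sideEvent`, the steep arm from the apex crosses the shadow rectangle
  `[s₀-W, s₀+W] × [h₀-k, T]` from bottom to top (with the vertical segment below the apex prepended) while the two shallow arms from the
  port cross it from left to right, so they pass through a common shadow (`exists_common_shadow_of_crossing`); the meeting is not on the
  segment (shallow arms live at heights `≥ N+1 > h₀`), hence a steep-arm vertex `z_Q` and a shallow-arm vertex `z_P` agree in the
  coordinates `0, i` and differ by `≤ 2k` elsewhere.  Opening the edges of three monotone junctions `u → u + σ(k+1)e_i → a` and
  `z_Q → z_P` (`≤ (k+1) + k + 2dk` edges, all inside `[-M₁, M₁]^d`) joins `u` to the port `w` through OPEN EXTERIOR steps: every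
  junction and arm step joins two sites of `ℍ` not both in the box.
* **`port`** — for every inner-boundary vertex `u` of `[-N,N]^d` (top face: port `u + e_0`, one edge; side face: the above): a port
  `w` with `N+1 ≤ w_0 ≤ N+1+k`, `|w_j| ≤ N+k+1`, and an increasing, measurable event `𝒜` determined by the edges in `[-M₁,M₁]^d`,
  `M₁ = 3(N+4k+1)`, with `P_{p'}(𝒜) ≥ α³`, on which `≤ 2dk+2k+1` extra open edges inside `[-M₁,M₁]^d` give `u ↔ w` through
  open exterior steps.
[cite: AizenmanChayesChayesFrohlichRusso1983, §4 Lemma 4.2 (a), Lemma 4.3 and Cor.] [cite: BarskyGrimmettNewman1991, Comment 6 p. 116] -/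

noncomputable section

namespace Summit.CriticalPhenomena.PercolationContinuityZ3.Theorems.Transplant

namespace HSU

open MeasureTheory Literature.Probability.Percolation Literature.Probability.LatticeModels SimpleGraph PlanarCone
open scoped Classical

variable {d : ℕ} [NeZero d] {p' : unitInterval}

/-! ## §1 Junction bookkeeping -/

omit [NeZero d] in
/-- The bounding box of two sites with all coordinates bounded by `M` lies in `[-M, M]^d`. [folklore] -/
theorem bbox_subset_boxSet {x y : Site d} {M : ℕ} (hx : ∀ j, |x j| ≤ M) (hy : ∀ j, |y j| ≤ M) :
    {z : Site d | ∀ j, min (x j) (y j) ≤ z j ∧ z j ≤ max (x j) (y j)} ⊆ boxSet d M := by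
  refine subset_boxSet_of_abs_le fun z hz j => ?_
  have h1 := hx j; have h2 := hy j; have h3 := hz j
  rw [abs_le] at h1 h2 ⊢
  constructor
  · exact le_trans (le_min h1.1 h2.1) h3.1
  · exact le_trans h3.2 (max_le h1.2 h2.2)

omit [NeZero d] in
/-- `l1dist` of two sites differing in one coordinate. [folklore] -/
theorem l1dist_of_eq_off {x y : Site d} (j₀ : Fin d) (h : ∀ j, j ≠ j₀ → x j = y j) : l1dist x y = (x j₀ - y j₀).natAbs := by
  unfold l1dist
  rw [Finset.sum_eq_single j₀ (fun j _ hj => by rw [h j hj, sub_self]; rfl) (fun h => (h (Finset.mem_univ _)).elim)]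

omit [NeZero d] in
/-- A junction edge set inside a region `S` with `withinGraph ℤ^d S ≤ K` connects its ends in `openGraph (ω ∪ F') ⊓ K` for any `F' ⊇ F`.
[folklore] -/
theorem reachable_of_junction {F F' : Finset (Sym2 (Site d))} {S : Set (Site d)} {K : SimpleGraph (Site d)} {ω : BondConfig (Site d)}
    {x y : Site d} (h : (openGraph (↑F : BondConfig (Site d)) ⊓ withinGraph (zdGraph d) S).Reachable x y) (hFF' : F ⊆ F')
    (hSK : withinGraph (zdGraph d) S ≤ K) : (openGraph (ω ∪ ↑F') ⊓ K).Reachable x y :=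
  h.mono (inf_le_inf (openGraph_mono fun _ he => Or.inr (Finset.mem_coe.2 (hFF' (Finset.mem_coe.1 he)))) hSK)

omit [NeZero d] in
/-- An arm piece inside a region `S` with `withinGraph ℤ^d S ≤ K` connects in `openGraph (ω ∪ F) ⊓ K`. [folklore] -/
theorem reachable_of_arm {F : Finset (Sym2 (Site d))} {S : Set (Site d)} {K : SimpleGraph (Site d)} {ω : BondConfig (Site d)}
    {x y : Site d} (h : (openGraph ω ⊓ withinGraph (zdGraph d) S).Reachable x y) (hSK : withinGraph (zdGraph d) S ≤ K) :
    (openGraph (ω ∪ ↑F) ⊓ K).Reachable x y :=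
  h.mono (inf_le_inf (openGraph_mono Set.subset_union_left) hSK)

/-- **Port on the top face**: one exterior edge joins `u` (`u_0 = N`) to `u + e_0`. [folklore] -/
theorem port_top {N : ℕ} {u : Site d} (hu0 : u 0 = N) (ω : BondConfig (Site d)) :
    ω ∪ ↑({s(u, u + Pi.single 0 1)} : Finset (Sym2 (Site d))) ∈ openConnVia (extGraph d N) u (u + Pi.single 0 1) := by
  refine mem_openConnVia_iff.2 (Adj.reachable ?_)
  rw [SimpleGraph.inf_adj, openGraph_adj]
  have hadj : (zdGraph d).Adj u (u + Pi.single 0 1) := (zdGraph_adj_iff _ _).2 ⟨0, Or.inl rfl⟩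
  refine ⟨⟨by simp, hadj.ne⟩, extGraph_adj_of hadj (by omega) (by simp; omega) fun hb => ?_⟩
  have := (mem_boxSet_iff.1 hb.2) 0
  simp at this; omega

/-! ## §2 The move on the side event -/

section Side

variable (A : ArmKit d p') {N : ℕ} {u : Site d} {i : Fin d} {σ : ℤ}

/-- The corner `u + σ(k+1) e_i` of the path `u → apex`. [folklore] -/
def corner (A : ArmKit d p') (N : ℕ) (u : Site d) (i : Fin d) (σ : ℤ) : Site d :=
  fun j => if j = i then σ * (N + A.k + 1) else u j

/-- **The crossing.** On the side event, some vertex `z_Q` of the steep arm (reached from the apex inside the steep region) and some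
vertex `z_P` of a shallow arm (reached from the port inside its region) have the same shadow on the `(x_i, x_0)`-plane.
[cite: AizenmanChayesChayesFrohlichRusso1983, §4 Lemma 4.3 (overlapping paths)] -/
theorem sideEvent_crossing (hi : i ≠ 0) (hσ : σ = 1 ∨ σ = -1) (hkN : A.k ≤ N) (hu0 : 0 ≤ u 0) (hu0N : u 0 ≤ (N : ℤ) - 1)
    (hubox : u ∈ boxSet d N) {ω : BondConfig (Site d)} (hω : ω ∈ sideEvent A N u i σ) :
    ∃ zQ zP : Site d, zQ ∈ steepRegion A N u i σ ∧ zQ i = zP i ∧ zQ 0 = zP 0 ∧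
      (openGraph ω ⊓ withinGraph (zdGraph d) (steepRegion A N u i σ)).Reachable (apex A N u i σ) zQ ∧
      ((zP ∈ leftRegion A N u i σ ∧ (openGraph ω ⊓ withinGraph (zdGraph d) (leftRegion A N u i σ)).Reachable (sidePort A N u i σ) zP) ∨
       (zP ∈ rightRegion A N u i σ ∧ (openGraph ω ⊓ withinGraph (zdGraph d) (rightRegion A N u i σ)).Reachable (sidePort A N u i σ) zP)) := by
  obtain ⟨ha0, hai, hw0, hwi, hrest⟩ := apex_coords A hi (N := N) (u := u) (σ := σ)
  obtain ⟨c1, c2, c3, c4, c5, c6, c7, c8, c9⟩ := constants_facts A hkN hu0N (u := u)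
  set a := apex A N u i σ with ha_def
  set w := sidePort A N u i σ with hw_def
  -- the three arms
  obtain ⟨⟨zS, hzS, hS⟩, ⟨zP, hzP, hRP⟩, ⟨zM, hzM, hRM⟩⟩ := hω
  simp only [Set.mem_setOf_eq] at hzS hzP hzM
  obtain ⟨Q₀⟩ := mem_openConnVia_iff.1 hS
  obtain ⟨P₀⟩ := mem_openConnVia_iff.1 hRP
  obtain ⟨M₀⟩ := mem_openConnVia_iff.1 hRM
  have ha_mem : a ∈ steepRegion A N u i σ :=
    ⟨self_mem_shiftSet (zero_mem_blockThickening (zero_mem_cone _ _ _ _) _), by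
      show a 0 ≤ top A N u
      rw [ha0, c7]; omega⟩
  have hw_memR : w ∈ rightRegion A N u i σ :=
    ⟨self_mem_shiftSet (zero_mem_blockThickening (zero_mem_cone _ _ _ _) _), by
      show w i ≤ σ * (N + A.k + 1) + width A N u
      rw [hwi]; omega⟩
  have hw_memL : w ∈ leftRegion A N u i σ :=
    ⟨self_mem_shiftSet (zero_mem_blockThickening (zero_mem_cone _ _ _ _) _), by
      show σ * (N + A.k + 1) - width A N u ≤ w i
      rw [hwi]; omega⟩
  have hQsupp : ∀ z ∈ Q₀.support, z ∈ steepRegion A N u i σ := support_subset_of_walk_within Q₀ ha_mem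
  have hPsupp : ∀ z ∈ P₀.support, z ∈ rightRegion A N u i σ := support_subset_of_walk_within P₀ hw_memR
  have hMsupp : ∀ z ∈ M₀.support, z ∈ leftRegion A N u i σ := support_subset_of_walk_within M₀ hw_memL
  -- lattice walks
  let Q := Q₀.mapLe (openGraph_inf_withinGraph_le ω _)
  let P := P₀.mapLe (openGraph_inf_withinGraph_le ω _)
  let Mw := M₀.mapLe (openGraph_inf_withinGraph_le ω _)
  -- the vertical segment below the apex
  set b₀ : Site d := a + (A.k : ℤ) • Pi.single 0 (-1) with hb₀
  obtain ⟨Wseg, hWseg⟩ := exists_straight_walk b₀ 0 (Or.inl rfl : (1 : ℤ) = 1 ∨ (1 : ℤ) = -1) A.k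
  have hb₀a : b₀ + (A.k : ℤ) • Pi.single (0 : Fin d) (1 : ℤ) = a := by
    ext j; by_cases hj : j = 0
    · subst hj; simp [hb₀]
    · simp [hb₀, hj]
  have hseg_coord : ∀ z ∈ Wseg.support, z i = σ * (N + A.k + 1) ∧ max (u 0) (A.k : ℤ) - A.k ≤ z 0 ∧ z 0 ≤ max (u 0) A.k := by
    intro z hz
    obtain ⟨m, hm, rfl⟩ := hWseg z hz
    have hm' : (m : ℤ) ≤ A.k := by exact_mod_cast hm
    have h0 : (b₀ + (m : ℤ) • (Pi.single 0 1 : Site d)) 0 = max (u 0) (A.k : ℤ) - A.k + m := by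
      simp [hb₀, ha0]; ring
    have hii : (b₀ + (m : ℤ) • (Pi.single 0 1 : Site d)) i = σ * (N + A.k + 1) := by
      simp [hb₀, hi, hai]
    refine ⟨hii, ?_, ?_⟩ <;> rw [h0] <;> omega
  let Qfull := (Wseg.copy rfl hb₀a).append Q
  let Pfull := Mw.reverse.append P
  have hPbd : ∀ z ∈ Pfull.support, σ * (N + A.k + 1) - width A N u ≤ z i ∧ z i ≤ σ * (N + A.k + 1) + width A N u ∧
      max (u 0) (A.k : ℤ) - A.k ≤ z 0 ∧ z 0 ≤ top A N u := by
    intro z hz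
    rcases (Walk.mem_support_append_iff _ _).1 hz with hz | hz
    · rw [Walk.support_reverse, List.mem_reverse, Walk.support_mapLe_eq_support] at hz
      obtain ⟨h1, h2, h3, h4, -⟩ := leftRegion_props A hi hσ hkN hu0 hu0N hubox (hMsupp z hz); exact ⟨h2, h3, by omega, h4⟩
    · rw [Walk.support_mapLe_eq_support] at hz
      obtain ⟨h1, h2, h3, h4, -⟩ := rightRegion_props A hi hσ hkN hu0 hu0N hubox (hPsupp z hz); exact ⟨h2, h3, by omega, h4⟩
  have hQbd : ∀ z ∈ Qfull.support, σ * (N + A.k + 1) - width A N u ≤ z i ∧ z i ≤ σ * (N + A.k + 1) + width A N u ∧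
      max (u 0) (A.k : ℤ) - A.k ≤ z 0 ∧ z 0 ≤ top A N u := by
    intro z hz
    rcases (Walk.mem_support_append_iff _ _).1 hz with hz | hz
    · rw [Walk.support_copy] at hz
      obtain ⟨h1, h2, h3⟩ := hseg_coord z hz
      refine ⟨by omega, by omega, h2, ?_⟩
      rw [c7]; omega
    · rw [Walk.support_mapLe_eq_support] at hz
      obtain ⟨-, -, h3, h4, h5, -⟩ := steepRegion_props A hi hσ hkN hu0 hu0N hubox (hQsupp z hz)
      rw [abs_le] at h3; exact ⟨by omega, by omega, h4, h5⟩
  have hb₀0 : b₀ 0 = max (u 0) (A.k : ℤ) - A.k := by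
    simp [hb₀, ha0]; omega
  obtain ⟨zPt, hzPt, zQt, hzQt, hIi, hI0⟩ :=
    exists_common_shadow_of_crossing hi Pfull Qfull hPbd hQbd hzM hzP hb₀0 hzS
  -- where the meeting points are
  have hzPt_reg : zPt ∈ leftRegion A N u i σ ∧ zPt ∈ M₀.support ∨ zPt ∈ rightRegion A N u i σ ∧ zPt ∈ P₀.support := by
    rcases (Walk.mem_support_append_iff _ _).1 hzPt with hz | hz
    · rw [Walk.support_reverse, List.mem_reverse, Walk.support_mapLe_eq_support] at hz
      exact Or.inl ⟨hMsupp zPt hz, hz⟩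
    · rw [Walk.support_mapLe_eq_support] at hz
      exact Or.inr ⟨hPsupp zPt hz, hz⟩
  have hzPt0 : (N : ℤ) + 1 ≤ zPt 0 := by
    rcases hzPt_reg with ⟨h, -⟩ | ⟨h, -⟩
    · exact (leftRegion_props A hi hσ hkN hu0 hu0N hubox h).1
    · exact (rightRegion_props A hi hσ hkN hu0 hu0N hubox h).1
  have hzQt_Q : zQt ∈ Q₀.support := by
    rcases (Walk.mem_support_append_iff _ _).1 hzQt with hz | hz
    · exfalso
      rw [Walk.support_copy] at hz
      have := (hseg_coord zQt hz).2.2; omega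
    · rwa [Walk.support_mapLe_eq_support] at hz
  refine ⟨zQt, zPt, hQsupp zQt hzQt_Q, hIi.symm, hI0.symm, reachable_of_mem_support' Q₀ zQt hzQt_Q, ?_⟩
  rcases hzPt_reg with ⟨h, hz⟩ | ⟨h, hz⟩
  · exact Or.inl ⟨h, reachable_of_mem_support' M₀ zPt hz⟩
  · exact Or.inr ⟨h, reachable_of_mem_support' P₀ zPt hz⟩

/-- **The move on the side event**: `≤ 2dk + 2k + 1` extra open edges inside `[-M₁, M₁]^d` join `u` to its port through open exterior
steps. [cite: AizenmanChayesChayesFrohlichRusso1983, §4 Lemma 4.3 (overlap ⇒ E_k Ξ) and Lemma 4.2 (a)] -/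
theorem sideEvent_move (hi : i ≠ 0) (hσ : σ = 1 ∨ σ = -1) (hkN : A.k ≤ N) (hu0 : 0 ≤ u 0) (hu0N : u 0 ≤ (N : ℤ) - 1)
    (hui : u i = σ * N) (hubox : u ∈ boxSet d N) {ω : BondConfig (Site d)} (hω : ω ∈ sideEvent A N u i σ) :
    ∃ F : Finset (Sym2 (Site d)), F ⊆ edgesIn (zdGraph d) (box d (3 * (N + 4 * A.k + 1))) ∧
      F.card ≤ 2 * d * A.k + 2 * A.k + 1 ∧ ω ∪ ↑F ∈ openConnVia (extGraph d N) u (sidePort A N u i σ) := by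
  obtain ⟨ha0, hai, hw0, hwi, hrest⟩ := apex_coords A hi (N := N) (u := u) (σ := σ)
  obtain ⟨c1, c2, c3, c4, c5, c6, c7, c8, c9⟩ := constants_facts A hkN hu0N (u := u)
  have hubj : ∀ j, |u j| ≤ N := fun j => abs_le.2 (by have := (mem_boxSet_iff.1 hubox) j; omega)
  have hσabs : σ.natAbs = 1 := by rcases hσ with rfl | rfl <;> rfl
  have hs₀abs : |σ * ((N : ℤ) + A.k + 1)| = N + A.k + 1 := by
    rcases hσ with rfl | rfl
    · rw [one_mul, abs_of_nonneg (by positivity)]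
    · rw [neg_one_mul, abs_neg, abs_of_nonneg (by positivity)]
  have hs₀σ : σ * (σ * ((N : ℤ) + A.k + 1)) = N + A.k + 1 := by
    rcases hσ with rfl | rfl <;> ring
  set a := apex A N u i σ with ha_def
  set w := sidePort A N u i σ with hw_def
  set cnr := corner A N u i σ with hc_def
  have hci : cnr i = σ * (N + A.k + 1) := by simp [hc_def, corner]
  have hcj : ∀ j, j ≠ i → cnr j = u j := fun j hj => by simp [hc_def, corner, hj]
  -- the crossing
  obtain ⟨zQ, zP, hzQreg, hIi, hI0, hQreach, hPreach⟩ := sideEvent_crossing A hi hσ hkN hu0 hu0N hubox hω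
  obtain ⟨hzQ0, hzQi, -, -, -, hzQoff, hzQbd⟩ := steepRegion_props A hi hσ hkN hu0 hu0N hubox hzQreg
  have hzP_facts : (N : ℤ) + 1 ≤ zP 0 ∧ (∀ j, j ≠ 0 → j ≠ i → |zP j - u j| ≤ A.k) ∧ ∀ j, |zP j| ≤ (3 * (N + 4 * A.k + 1) : ℕ) := by
    rcases hPreach with ⟨h, -⟩ | ⟨h, -⟩
    · obtain ⟨h1, -, -, -, h5, h6⟩ := leftRegion_props A hi hσ hkN hu0 hu0N hubox h; exact ⟨h1, h5, h6⟩
    · obtain ⟨h1, -, -, -, h5, h6⟩ := rightRegion_props A hi hσ hkN hu0 hu0N hubox h; exact ⟨h1, h5, h6⟩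
  obtain ⟨hzP0, hzPoff, hzPbd⟩ := hzP_facts
  -- the three junctions
  obtain ⟨F₁, hF₁c, hF₁s, hF₁r⟩ := exists_junction u cnr
  obtain ⟨F₂, hF₂c, hF₂s, hF₂r⟩ := exists_junction cnr a
  obtain ⟨F₃, hF₃c, hF₃s, hF₃r⟩ := exists_junction zQ zP
  have hd1 : l1dist u cnr ≤ A.k + 1 := by
    rw [l1dist_of_eq_off i fun j hj => (hcj j hj).symm, hui, hci]
    have : σ * (N : ℤ) - σ * (N + A.k + 1) = -(σ * (A.k + 1)) := by ring
    rw [this, Int.natAbs_neg, Int.natAbs_mul, hσabs, one_mul]; omega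
  have hd2 : l1dist cnr a ≤ A.k := by
    have hoff : ∀ j, j ≠ 0 → cnr j = a j := by
      intro j hj
      by_cases hji : j = i
      · subst hji; rw [hci, hai]
      · rw [hcj j hji, (hrest j hj hji).1]
    rw [l1dist_of_eq_off 0 hoff, hcj 0 (Ne.symm hi), ha0]
    rcases c9 with h | h <;> rw [h] <;> omega
  have hd3 : l1dist zQ zP ≤ d * (2 * A.k) := by
    refine l1dist_le_of_forall_le fun j => ?_
    by_cases hj0 : j = 0
    · subst hj0; rw [hI0, sub_self, abs_zero]; positivity
    · by_cases hji : j = i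
      · subst hji; rw [hIi, sub_self, abs_zero]; positivity
      · have h1 := hzQoff j hj0 hji; have h2 := hzPoff j hj0 hji
        calc |zQ j - zP j| = |(zQ j - u j) - (zP j - u j)| := by ring_nf
          _ ≤ |zQ j - u j| + |zP j - u j| := abs_sub _ _
          _ ≤ (2 * A.k : ℕ) := by push_cast; omega
  have hcnr_bd : ∀ j, |cnr j| ≤ (3 * (N + 4 * A.k + 1) : ℕ) := by
    intro j; by_cases hji : j = i
    · subst hji; rw [hci, hs₀abs]; push_cast; omega
    · rw [hcj j hji]; have := hubj j; rw [abs_le] at this ⊢; constructor <;> push_cast <;> omega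
  have ha_mem : a ∈ steepRegion A N u i σ :=
    ⟨self_mem_shiftSet (zero_mem_blockThickening (zero_mem_cone _ _ _ _) _), by
      show a 0 ≤ top A N u
      rw [ha0, c7]; omega⟩
  have ha_bd : ∀ j, |a j| ≤ (3 * (N + 4 * A.k + 1) : ℕ) := (steepRegion_props A hi hσ hkN hu0 hu0N hubox ha_mem).2.2.2.2.2.2
  have hu_bd : ∀ j, |u j| ≤ (3 * (N + 4 * A.k + 1) : ℕ) := fun j => by
    have := hubj j; rw [abs_le] at this ⊢; constructor <;> push_cast <;> omega
  refine ⟨F₁ ∪ F₂ ∪ F₃, ?_, ?_, ?_⟩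
  · -- inside the window
    intro e he
    rcases Finset.mem_union.1 he with he | he
    · rcases Finset.mem_union.1 he with he | he
      · exact edgeSet_withinGraph_subset_edgesIn (bbox_subset_boxSet hu_bd hcnr_bd) (hF₁s (Finset.mem_coe.2 he))
      · exact edgeSet_withinGraph_subset_edgesIn (bbox_subset_boxSet hcnr_bd ha_bd) (hF₂s (Finset.mem_coe.2 he))
    · exact edgeSet_withinGraph_subset_edgesIn (bbox_subset_boxSet hzQbd hzPbd) (hF₃s (Finset.mem_coe.2 he))
  · -- the count
    calc (F₁ ∪ F₂ ∪ F₃).card ≤ (F₁ ∪ F₂).card + F₃.card := Finset.card_union_le _ _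
      _ ≤ (F₁.card + F₂.card) + F₃.card := by gcongr; exact Finset.card_union_le _ _
      _ ≤ (A.k + 1 + A.k) + d * (2 * A.k) := by gcongr <;> omega
      _ = 2 * d * A.k + 2 * A.k + 1 := by ring
  · -- the connection through exterior steps
    refine mem_openConnVia_iff.2 ?_
    have r1 : (openGraph (ω ∪ ↑(F₁ ∪ F₂ ∪ F₃)) ⊓ extGraph d N).Reachable u cnr :=
      reachable_of_junction hF₁r (Finset.subset_union_left.trans Finset.subset_union_left)
        (bbox_segment_le_extGraph hσ hu0 hui (by rw [hci, hs₀σ]; omega) hcj hi)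
    have r2 : (openGraph (ω ∪ ↑(F₁ ∪ F₂ ∪ F₃)) ⊓ extGraph d N).Reachable cnr a := by
      refine reachable_of_junction hF₂r (Finset.subset_union_right.trans Finset.subset_union_left)
        (withinGraph_le_extGraph_of_forall_not_mem fun z hz => ⟨?_, not_mem_boxSet_of_lt (j := i) ?_⟩)
      · have h1 := (hz 0).1; rw [hcj 0 (Ne.symm hi), ha0] at h1
        exact le_trans hu0 (le_trans (le_min le_rfl c1) h1)
      · rw [eq_of_mem_bbox hz (show cnr i = a i by rw [hci, hai]), hci, hs₀abs]; omega
    have r3 : (openGraph (ω ∪ ↑(F₁ ∪ F₂ ∪ F₃)) ⊓ extGraph d N).Reachable a zQ :=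
      reachable_of_arm hQreach (withinGraph_le_extGraph_of_forall_not_mem fun z hz =>
        ⟨(steepRegion_props A hi hσ hkN hu0 hu0N hubox hz).1, not_mem_boxSet_of_lt (steepRegion_props A hi hσ hkN hu0 hu0N hubox hz).2.1⟩)
    have r4 : (openGraph (ω ∪ ↑(F₁ ∪ F₂ ∪ F₃)) ⊓ extGraph d N).Reachable zQ zP := by
      refine reachable_of_junction hF₃r Finset.subset_union_right
        (withinGraph_le_extGraph_of_forall_not_mem fun z hz => ⟨?_, not_mem_boxSet_of_lt (j := i) ?_⟩)
      · rw [eq_of_mem_bbox hz hI0]; exact hzQ0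
      · rw [eq_of_mem_bbox hz hIi]; exact hzQi
    have r5 : (openGraph (ω ∪ ↑(F₁ ∪ F₂ ∪ F₃)) ⊓ extGraph d N).Reachable zP w := by
      rcases hPreach with ⟨-, hr⟩ | ⟨-, hr⟩
      · refine (reachable_of_arm hr ?_).symm
        exact withinGraph_le_extGraph_of_forall_not_mem fun z hz' =>
          ⟨by have := (leftRegion_props A hi hσ hkN hu0 hu0N hubox hz').1; omega,
            not_mem_boxSet_of_lt (j := 0) (by have := (leftRegion_props A hi hσ hkN hu0 hu0N hubox hz').1; rw [abs_of_nonneg (by omega)]; omega)⟩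
      · refine (reachable_of_arm hr ?_).symm
        exact withinGraph_le_extGraph_of_forall_not_mem fun z hz' =>
          ⟨by have := (rightRegion_props A hi hσ hkN hu0 hu0N hubox hz').1; omega,
            not_mem_boxSet_of_lt (j := 0) (by have := (rightRegion_props A hi hσ hkN hu0 hu0N hubox hz').1; rw [abs_of_nonneg (by omega)]; omega)⟩
    exact r1.trans (r2.trans (r3.trans (r4.trans r5)))

end Side

/-! ## §3 The port lemma -/

/-- **The port lemma.**  Let `A` be an arm kit at density `p'` with offset `k ≤ N`, `d ≥ 2`.  Every vertex `u` of `[-N,N]^d` having a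
half-space neighbour outside the box admits a PORT `w` (`N+1 ≤ w_0 ≤ N+1+k`, `|w_j| ≤ N+k+1` for all `j`) and an increasing
measurable event `𝒜`, determined by the lattice edges inside `[-M₁, M₁]^d` (`M₁ = 3(N+4k+1)`) and of probability `≥ α³`, such that
for every `ω ∈ 𝒜` some `≤ 2dk+2k+1` lattice edges inside `[-M₁, M₁]^d`, declared open, join `u` to `w` through open EXTERIOR steps
of the box.  [cite: AizenmanChayesChayesFrohlichRusso1983, §4 Cor. to Lemma 4.3] [cite: BarskyGrimmettNewman1991, Comment 6 p. 116] -/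
theorem port (hd : 2 ≤ d) (A : ArmKit d p') {N : ℕ} (hkN : A.k ≤ N) {u : Site d} (hubox : u ∈ boxSet d N)
    (hw : ∃ w, w ∉ boxSet d N ∧ (hsGraph d).Adj u w) :
    ∃ (w : Site d) (𝒜 : Set (BondConfig (Site d))),
      (N : ℤ) + 1 ≤ w 0 ∧ w 0 ≤ N + 1 + A.k ∧ (∀ j, |w j| ≤ N + A.k + 1) ∧
      IsUpperSet 𝒜 ∧ MeasurableSet 𝒜 ∧ DeterminedBy 𝒜 ↑(edgesIn (zdGraph d) (box d (3 * (N + 4 * A.k + 1)))) ∧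
      A.α ^ 3 ≤ (bondPercolation (zdGraph d) p').real 𝒜 ∧
      ∀ ω ∈ 𝒜, ∃ F : Finset (Sym2 (Site d)), F ⊆ edgesIn (zdGraph d) (box d (3 * (N + 4 * A.k + 1))) ∧
        F.card ≤ 2 * d * A.k + 2 * A.k + 1 ∧ ω ∪ ↑F ∈ openConnVia (extGraph d N) u w := by
  have hubj : ∀ j, -(N : ℤ) ≤ u j ∧ u j ≤ N := mem_boxSet_iff.1 hubox
  have hα1 : A.α ≤ 1 := by
    have h1 : (⟨1, by omega⟩ : Fin d) ≠ 0 := by simp [Fin.ext_iff]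
    exact (A.steep_arm ⟨1, by omega⟩ h1 1 (Or.inl rfl) 0).trans measureReal_le_one
  have hα3 : A.α ^ 3 ≤ 1 := pow_le_one₀ A.α_pos.le hα1
  obtain ⟨hu0, htop | ⟨i, hi, σ, hσ, hui⟩⟩ := innerBdry_cases hubox hw
  · -- TOP face
    refine ⟨u + Pi.single 0 1, Set.univ, ?_, ?_, ?_, isUpperSet_univ, MeasurableSet.univ, determinedBy_univ _, ?_, fun ω _ => ?_⟩
    · simp [htop]
    · simp [htop]
    · intro j; by_cases hj : j = 0
      · subst hj; simp [htop]; rw [abs_of_nonneg (by positivity)]; omega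
      · simp [hj]; rw [abs_le]; have := hubj j; constructor <;> omega
    · rw [probReal_univ]; exact hα3
    · refine ⟨{s(u, u + Pi.single 0 1)}, ?_, by simp, port_top htop ω⟩
      intro e he
      rw [Finset.mem_singleton] at he; subst he
      rw [mem_edgesIn_iff]
      refine ⟨(SimpleGraph.mem_edgeSet _).2 ((zdGraph_adj_iff _ _).2 ⟨0, Or.inl rfl⟩), fun v hv => ?_⟩
      rw [mem_box]
      rcases Sym2.mem_iff.1 hv with rfl | rfl
      · intro j; have := hubj j; constructor <;> push_cast <;> omega
      · intro j; by_cases hj : j = 0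
        · subst hj; simp [htop]; constructor <;> omega
        · simp [hj]; have := hubj j; constructor <;> omega
  · -- SIDE face
    by_cases htop : u 0 = N
    · -- also on the top face: use the top port
      refine ⟨u + Pi.single 0 1, Set.univ, ?_, ?_, ?_, isUpperSet_univ, MeasurableSet.univ, determinedBy_univ _, ?_, fun ω _ => ?_⟩
      · simp [htop]
      · simp [htop]
      · intro j; by_cases hj : j = 0
        · subst hj; simp [htop]; rw [abs_of_nonneg (by positivity)]; omega
        · simp [hj]; rw [abs_le]; have := hubj j; constructor <;> omega
      · rw [probReal_univ]; exact hα3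
      · refine ⟨{s(u, u + Pi.single 0 1)}, ?_, by simp, port_top htop ω⟩
        intro e he
        rw [Finset.mem_singleton] at he; subst he
        rw [mem_edgesIn_iff]
        refine ⟨(SimpleGraph.mem_edgeSet _).2 ((zdGraph_adj_iff _ _).2 ⟨0, Or.inl rfl⟩), fun v hv => ?_⟩
        rw [mem_box]
        rcases Sym2.mem_iff.1 hv with rfl | rfl
        · intro j; have := hubj j; constructor <;> push_cast <;> omega
        · intro j; by_cases hj : j = 0
          · subst hj; simp [htop]; constructor <;> omega
          · simp [hj]; have := hubj j; constructor <;> omega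
    · have hu0N : u 0 ≤ (N : ℤ) - 1 := by have := (hubj 0).2; omega
      obtain ⟨-, -, hw0, hwi, hrest⟩ := apex_coords A hi (N := N) (u := u) (σ := σ)
      refine ⟨sidePort A N u i σ, sideEvent A N u i σ, by rw [hw0]; omega, by rw [hw0], ?_, sideEvent_upper A,
        sideEvent_measurable A, sideEvent_determinedBy A hi hσ hkN hu0 hu0N hubox, sideEvent_prob A hi hσ hkN hu0N,
        fun ω hω => sideEvent_move A hi hσ hkN hu0 hu0N hui hubox hω⟩
      intro j
      by_cases hj0 : j = 0
      · subst hj0; rw [hw0, abs_of_nonneg (by positivity)]; omega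
      · by_cases hji : j = i
        · subst hji; rw [hwi]; rcases hσ with rfl | rfl
          · rw [one_mul, abs_of_nonneg (by positivity)]
          · rw [show (-1 : ℤ) * (N + A.k + 1) = -(N + A.k + 1) by ring, abs_neg, abs_of_nonneg (by positivity)]
        · rw [(hrest j hj0 hji).2, abs_le]; have := hubj j; constructor <;> omega

end HSU

end Summit.CriticalPhenomena.PercolationContinuityZ3.Theorems.Transplant

end
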